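import Summits.CriticalPhenomena.PercolationContinuityZ3.Theorems.PercNearOneGluingNoHeavyLowerTailSahiOneStepCone
import HarnessLib

/-!
# One-step scheme: the `(2′)` half from a LUMPED PARTITION of the first slot (reduction lemma)

Support file (prover prim-ineq-prove-3 gen 18; `--supports stmt-CriticalPhenomena-4575`; memo
`run/shared/lean/prim/prim-ineq-prove-3/FINDING-G18-TREE-LUMP.md` §1).  No definitions, no named facts, no sorries, no `native_decide`.

The `(2′)` hypothesis of the one-step scheme (`…SahiOneStepCone.sahiE3_nonneg_of_ind`) for a first event `H` is
`0 ≤ n(1_A,1_B) = μ(A∖H)μ(B∖H) + μ(Hᶜ)μ(H∩A∩B) − μ(Hᶜ)μ(A)μ(B)` (`osN_ind_ind`), i.e. the POSITIVE CORRELATION of the block averages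
`E[1_A | 𝒫_H]`, `E[1_B | 𝒫_H]` for the partition `𝒫_H = {Hᶜ} ∪ {singletons of H}` of the cube (the complement `Hᶜ` collapsed to one block).
This file records the elementary REDUCTION behind the gen-18 conjecture TREE-LUMP: if `H` is covered by finitely many pairwise disjoint blocks
`P k ⊆ H` on each of which `A, B` are positively correlated (`μ(A∩P)μ(B∩P) ≤ μ(A∩B∩P)μ(P)` — automatic for sub-cube blocks by Harris, for chains
by Chebyshev), then the LUMPED inequality `μ(A)μ(B) ≤ Σ_k μ(A∩P k)μ(B∩P k)/μ(P k) + μ(A∖H)μ(B∖H)/μ(Hᶜ)` (positive correlation of the block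
averages for the coarser partition `{Hᶜ} ∪ {P k}`) implies `0 ≤ n(1_A,1_B)`.  For `H = Th_t(F)` and the first-passage sub-cubes of any query order
this is the route 'TREE-LUMP ⟹ (2′) ⟹ Kahn C5 for every threshold slot' of the memo (TREE-LUMP itself is verified, not proved).
-/

noncomputable section

namespace Summit.CriticalPhenomena.PercolationContinuityZ3.Theorems

namespace SahiOneStep

open MeasureTheory
open Literature.Probability.LatticeModels (prodBernoulli)
open Literature.Probability.Percolation.DecisionTree (ind)
open scoped Classical

variable {ι : Type*} [Fintype ι]

/-- `n` on indicators in 'lumped' form: `n(1_A,1_B) = μ(A∖H)·μ(B∖H) + μ(Hᶜ)·μ(H∩A∩B) − μ(Hᶜ)·μ(A)·μ(B)`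
(so that `n ≥ 0` is `Cov(A,B) ≥ μ(Hᶜ)·Cov(A,B ∣ Hᶜ)`). [this work] -/
theorem osN_ind_ind_lumped (p : ι → unitInterval) (H A B : Set (Set ι)) :
    osN p H (ind A) (ind B) =
      (prodBernoulli p).real (A ∩ Hᶜ) * (prodBernoulli p).real (B ∩ Hᶜ)
        + (prodBernoulli p).real Hᶜ * (prodBernoulli p).real (H ∩ A ∩ B)
        - (prodBernoulli p).real Hᶜ * (prodBernoulli p).real A * (prodBernoulli p).real B := by
  rw [osN_ind_ind]
  have hA : (prodBernoulli p).real (A ∩ Hᶜ) = (prodBernoulli p).real A - (prodBernoulli p).real (H ∩ A) := by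
    have h := measureReal_inter_add_sdiff (μ := prodBernoulli p) (s := A) (t := H) MeasurableSet.of_discrete
    rw [Set.inter_comm A H, Set.sdiff_eq] at h
    linarith
  have hB : (prodBernoulli p).real (B ∩ Hᶜ) = (prodBernoulli p).real B - (prodBernoulli p).real (H ∩ B) := by
    have h := measureReal_inter_add_sdiff (μ := prodBernoulli p) (s := B) (t := H) MeasurableSet.of_discrete
    rw [Set.inter_comm B H, Set.sdiff_eq] at h
    linarith
  have hH : (prodBernoulli p).real Hᶜ = 1 - (prodBernoulli p).real H := by
    have h := measureReal_add_measureReal_compl (μ := prodBernoulli p) (s := H) MeasurableSet.of_discrete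
    rw [probReal_univ] at h
    linarith
  rw [hA, hB, hH]
  ring

/-- **REDUCTION LEMMA (lumped partition ⟹ `(2′)`).**  Let `H` be covered by finitely many pairwise disjoint blocks `P k ⊆ H` (`k ∈ s`) on each of
which `A` and `B` are positively correlated, `μ(A∩P k)·μ(B∩P k) ≤ μ(A∩B∩P k)·μ(P k)`.  If the block averages of `1_A, 1_B` for the partition
`{Hᶜ} ∪ {P k}` are positively correlated — `μ(A)μ(B) ≤ Σ_k μ(A∩P k)μ(B∩P k)/μ(P k) + μ(A∩Hᶜ)μ(B∩Hᶜ)/μ(Hᶜ)` (real division, `x/0 = 0`) — then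
`0 ≤ n(1_A,1_B)`, the `(2′)` one-step hypothesis for `(H, A, B)`.  [this work] -/
theorem osN_ind_ind_nonneg_of_lumped (p : ι → unitInterval) {H A B : Set (Set ι)} {κ : Type*} (s : Finset κ) (P : κ → Set (Set ι))
    (hPH : ∀ k ∈ s, P k ⊆ H) (hdisj : (s : Set κ).PairwiseDisjoint P) (hcov : H ⊆ ⋃ k ∈ s, P k)
    (hblock : ∀ k ∈ s, (prodBernoulli p).real (A ∩ P k) * (prodBernoulli p).real (B ∩ P k) ≤
      (prodBernoulli p).real (A ∩ B ∩ P k) * (prodBernoulli p).real (P k))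
    (hlump : (prodBernoulli p).real A * (prodBernoulli p).real B ≤
      (∑ k ∈ s, (prodBernoulli p).real (A ∩ P k) * (prodBernoulli p).real (B ∩ P k) / (prodBernoulli p).real (P k))
        + (prodBernoulli p).real (A ∩ Hᶜ) * (prodBernoulli p).real (B ∩ Hᶜ) / (prodBernoulli p).real Hᶜ) :
    0 ≤ osN p H (ind A) (ind B) := by
  rw [osN_ind_ind_lumped]
  set μ := prodBernoulli p with hμ
  -- `μ(H ∩ A ∩ B) = Σ_k μ(A ∩ B ∩ P k)`
  have hHAB : H ∩ A ∩ B = ⋃ k ∈ s, (A ∩ B ∩ P k) := by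
    ext ω
    simp only [Set.mem_inter_iff, Set.mem_iUnion, exists_prop]
    constructor
    · rintro ⟨⟨hH, hA⟩, hB⟩
      have hω : ω ∈ ⋃ k ∈ s, P k := hcov hH
      simp only [Set.mem_iUnion, exists_prop] at hω
      obtain ⟨k, hk, hkω⟩ := hω
      exact ⟨k, hk, ⟨hA, hB⟩, hkω⟩
    · rintro ⟨k, hk, ⟨hA, hB⟩, hkω⟩
      exact ⟨⟨hPH k hk hkω, hA⟩, hB⟩
  have hdisj' : (s : Set κ).PairwiseDisjoint (fun k => A ∩ B ∩ P k) := by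
    intro i hi j hj hij
    exact Disjoint.mono Set.inter_subset_right Set.inter_subset_right (hdisj hi hj hij)
  have hsum : μ.real (H ∩ A ∩ B) = ∑ k ∈ s, μ.real (A ∩ B ∩ P k) := by
    rw [hHAB]
    exact measureReal_biUnion_finset hdisj' (fun k _ => MeasurableSet.of_discrete)
  -- blockwise: `μ(A∩P)μ(B∩P)/μ(P) ≤ μ(A∩B∩P)`
  have hk : ∀ k ∈ s, μ.real (A ∩ P k) * μ.real (B ∩ P k) / μ.real (P k) ≤ μ.real (A ∩ B ∩ P k) := by
    intro k hks
    by_cases h0 : μ.real (P k) = 0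
    · rw [h0, div_zero]; exact measureReal_nonneg
    · rw [div_le_iff₀ (lt_of_le_of_ne measureReal_nonneg (Ne.symm h0))]
      exact hblock k hks
  have hsum_le : (∑ k ∈ s, μ.real (A ∩ P k) * μ.real (B ∩ P k) / μ.real (P k)) ≤ μ.real (H ∩ A ∩ B) := by
    rw [hsum]; exact Finset.sum_le_sum hk
  -- the `Hᶜ` block: `μ(Hᶜ) · (μ(A∩Hᶜ)μ(B∩Hᶜ)/μ(Hᶜ)) = μ(A∩Hᶜ)μ(B∩Hᶜ)`
  have hL : μ.real Hᶜ * (μ.real (A ∩ Hᶜ) * μ.real (B ∩ Hᶜ) / μ.real Hᶜ) = μ.real (A ∩ Hᶜ) * μ.real (B ∩ Hᶜ) := by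
    by_cases h0 : μ.real Hᶜ = 0
    · have hA0 : μ.real (A ∩ Hᶜ) = 0 :=
        le_antisymm (h0 ▸ measureReal_mono Set.inter_subset_right) measureReal_nonneg
      rw [h0, hA0]; ring
    · field_simp
  have hℓ : 0 ≤ μ.real Hᶜ := measureReal_nonneg
  have key : μ.real Hᶜ * (μ.real A * μ.real B) ≤
      μ.real Hᶜ * ((∑ k ∈ s, μ.real (A ∩ P k) * μ.real (B ∩ P k) / μ.real (P k))
        + μ.real (A ∩ Hᶜ) * μ.real (B ∩ Hᶜ) / μ.real Hᶜ) :=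
    mul_le_mul_of_nonneg_left hlump hℓ
  have key2 : μ.real Hᶜ * (∑ k ∈ s, μ.real (A ∩ P k) * μ.real (B ∩ P k) / μ.real (P k)) ≤
      μ.real Hᶜ * μ.real (H ∩ A ∩ B) := mul_le_mul_of_nonneg_left hsum_le hℓ
  rw [mul_add, hL] at key
  nlinarith [key, key2]

/-- The same with the block hypothesis discharged for blocks on which Harris holds in the form used throughout the tree: if every block `P k`
is such that `μ(X ∩ P k)·μ(Y ∩ P k) ≤ μ(X ∩ Y ∩ P k)·μ(P k)` for ALL increasing `X, Y` (e.g. sub-cubes), the lumped inequality for the pair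
`(A, B)` of increasing events gives `0 ≤ n(1_A,1_B)`. [this work] -/
theorem osN_ind_ind_nonneg_of_lumped' (p : ι → unitInterval) {H A B : Set (Set ι)} (hA : IsUpperSet A) (hB : IsUpperSet B)
    {κ : Type*} (s : Finset κ) (P : κ → Set (Set ι))
    (hPH : ∀ k ∈ s, P k ⊆ H) (hdisj : (s : Set κ).PairwiseDisjoint P) (hcov : H ⊆ ⋃ k ∈ s, P k)
    (hblock : ∀ k ∈ s, ∀ X Y : Set (Set ι), IsUpperSet X → IsUpperSet Y →
      (prodBernoulli p).real (X ∩ P k) * (prodBernoulli p).real (Y ∩ P k) ≤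
        (prodBernoulli p).real (X ∩ Y ∩ P k) * (prodBernoulli p).real (P k))
    (hlump : (prodBernoulli p).real A * (prodBernoulli p).real B ≤
      (∑ k ∈ s, (prodBernoulli p).real (A ∩ P k) * (prodBernoulli p).real (B ∩ P k) / (prodBernoulli p).real (P k))
        + (prodBernoulli p).real (A ∩ Hᶜ) * (prodBernoulli p).real (B ∩ Hᶜ) / (prodBernoulli p).real Hᶜ) :
    0 ≤ osN p H (ind A) (ind B) :=
  osN_ind_ind_nonneg_of_lumped p s P hPH hdisj hcov (fun k hk => hblock k hk A B hA hB) hlump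

/-! ## Sub-cube blocks are admissible: Harris on a cylinder -/

open Literature.Probability.LatticeModels (prodBernoulli_harris prodBernoulli_real_inter_of_determinedBy)
open Literature.Probability.Percolation (DeterminedBy determinedBy_iff)

omit [Fintype ι] in
/-- Inside the cylinder `{ω ∩ K = y}` an event `X` coincides with its pattern section `{ω | ω ∖ K ∪ y ∈ X}`. [folklore] -/
theorem cylinder_inter_eq (K y : Set ι) (X : Set (Set ι)) :
    {ω : Set ι | ω ∩ K = y} ∩ X = {ω : Set ι | ω ∩ K = y} ∩ {ω : Set ι | ω \ K ∪ y ∈ X} := by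
  ext ω
  simp only [Set.mem_inter_iff, Set.mem_setOf_eq]
  constructor
  · rintro ⟨hK, hX⟩
    refine ⟨hK, ?_⟩
    have hω : ω \ K ∪ y = ω := by rw [← hK, Set.sdiff_union_inter]
    rwa [hω]
  · rintro ⟨hK, hX⟩
    refine ⟨hK, ?_⟩
    have hω : ω \ K ∪ y = ω := by rw [← hK, Set.sdiff_union_inter]
    rwa [hω] at hX

omit [Fintype ι] in
/-- The cylinder `{ω ∩ K = y}` is determined by `K`. [folklore] -/
theorem determinedBy_cylinder (K y : Set ι) : DeterminedBy {ω : Set ι | ω ∩ K = y} K := by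
  rw [determinedBy_iff]
  intro ω ω' h
  simp only [Set.mem_setOf_eq]
  rw [h]

omit [Fintype ι] in
/-- The pattern section `{ω | ω ∖ K ∪ y ∈ X}` is determined by `Kᶜ`. [folklore] -/
theorem determinedBy_patternSection (K y : Set ι) (X : Set (Set ι)) : DeterminedBy {ω : Set ι | ω \ K ∪ y ∈ X} Kᶜ := by
  rw [determinedBy_iff]
  intro ω ω' h
  simp only [Set.mem_setOf_eq]
  rw [Set.sdiff_eq, Set.sdiff_eq, h]

omit [Fintype ι] in
/-- The pattern section of an increasing event is increasing. [folklore] -/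
theorem isUpperSet_patternSection {X : Set (Set ι)} (hX : IsUpperSet X) (K y : Set ι) :
    IsUpperSet {ω : Set ι | ω \ K ∪ y ∈ X} := by
  intro ω ω' hle hω
  exact hX (Set.union_subset_union_left y (Set.sdiff_subset_sdiff_left hle)) hω

/-- `μ(C ∩ X) = μ(C) · μ(X^y)` for the cylinder `C = {ω ∩ K = y}` (`K` finite) and the pattern section `X^y = {ω | ω ∖ K ∪ y ∈ X}`. [folklore] -/
theorem real_cylinder_inter (p : ι → unitInterval) (K : Finset ι) (y : Set ι) (X : Set (Set ι)) :
    (prodBernoulli p).real ({ω : Set ι | ω ∩ (K : Set ι) = y} ∩ X) =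
      (prodBernoulli p).real {ω : Set ι | ω ∩ (K : Set ι) = y} * (prodBernoulli p).real {ω : Set ι | ω \ (K : Set ι) ∪ y ∈ X} := by
  rw [cylinder_inter_eq]
  exact prodBernoulli_real_inter_of_determinedBy p K (determinedBy_cylinder _ _) (determinedBy_patternSection _ _ X)
    MeasurableSet.of_discrete MeasurableSet.of_discrete

/-- **Harris on a sub-cube block.**  For a cylinder `C = {ω ∩ K = y}` (`K` finite) and increasing `A, B`:
`μ(A ∩ C)·μ(B ∩ C) ≤ μ(A ∩ B ∩ C)·μ(C)` — the block hypothesis of `osN_ind_ind_nonneg_of_lumped'` for every partition of `H` into sub-cubes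
(e.g. the first-passage sub-cubes of a threshold event: the TREE-LUMP route of the memo). [this work] -/
theorem harris_cylinder (p : ι → unitInterval) (K : Finset ι) (y : Set ι) {A B : Set (Set ι)} (hA : IsUpperSet A) (hB : IsUpperSet B) :
    (prodBernoulli p).real (A ∩ {ω : Set ι | ω ∩ (K : Set ι) = y}) * (prodBernoulli p).real (B ∩ {ω : Set ι | ω ∩ (K : Set ι) = y}) ≤
      (prodBernoulli p).real (A ∩ B ∩ {ω : Set ι | ω ∩ (K : Set ι) = y}) * (prodBernoulli p).real {ω : Set ι | ω ∩ (K : Set ι) = y} := by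
  rw [Set.inter_comm A, Set.inter_comm B, Set.inter_comm (A ∩ B), real_cylinder_inter, real_cylinder_inter, real_cylinder_inter]
  have hAB : {ω : Set ι | ω \ (K : Set ι) ∪ y ∈ A ∩ B} = {ω : Set ι | ω \ (K : Set ι) ∪ y ∈ A} ∩ {ω : Set ι | ω \ (K : Set ι) ∪ y ∈ B} := by
    ext ω; simp only [Set.mem_setOf_eq, Set.mem_inter_iff]
  rw [hAB]
  have h := prodBernoulli_harris p (isUpperSet_patternSection hA (K : Set ι) y) (isUpperSet_patternSection hB (K : Set ι) y)
    MeasurableSet.of_discrete MeasurableSet.of_discrete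
  have hC : 0 ≤ (prodBernoulli p).real {ω : Set ι | ω ∩ (K : Set ι) = y} := measureReal_nonneg
  nlinarith [mul_le_mul_of_nonneg_left h (mul_nonneg hC hC)]

/-- **Reduction for sub-cube partitions.**  If `H` is partitioned into finitely many cylinders `{ω ∩ K k = y k}` (`k ∈ s`) and the block averages of
`1_A, 1_B` (increasing) for `{Hᶜ} ∪ {blocks}` are positively correlated, then `0 ≤ n(1_A,1_B)`. [this work] -/
theorem osN_ind_ind_nonneg_of_lumped_cylinders (p : ι → unitInterval) {H A B : Set (Set ι)} (hA : IsUpperSet A) (hB : IsUpperSet B)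
    {κ : Type*} (s : Finset κ) (K : κ → Finset ι) (y : κ → Set ι)
    (hPH : ∀ k ∈ s, {ω : Set ι | ω ∩ (K k : Set ι) = y k} ⊆ H)
    (hdisj : (s : Set κ).PairwiseDisjoint fun k => {ω : Set ι | ω ∩ (K k : Set ι) = y k})
    (hcov : H ⊆ ⋃ k ∈ s, {ω : Set ι | ω ∩ (K k : Set ι) = y k})
    (hlump : (prodBernoulli p).real A * (prodBernoulli p).real B ≤
      (∑ k ∈ s, (prodBernoulli p).real (A ∩ {ω : Set ι | ω ∩ (K k : Set ι) = y k}) *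
          (prodBernoulli p).real (B ∩ {ω : Set ι | ω ∩ (K k : Set ι) = y k}) / (prodBernoulli p).real {ω : Set ι | ω ∩ (K k : Set ι) = y k})
        + (prodBernoulli p).real (A ∩ Hᶜ) * (prodBernoulli p).real (B ∩ Hᶜ) / (prodBernoulli p).real Hᶜ) :
    0 ≤ osN p H (ind A) (ind B) :=
  osN_ind_ind_nonneg_of_lumped' p hA hB s (fun k => {ω : Set ι | ω ∩ (K k : Set ι) = y k}) hPH hdisj hcov
    (fun k _ _ _ hX hY => harris_cylinder p (K k) (y k) hX hY) hlump

end SahiOneStep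

end Summit.CriticalPhenomena.PercolationContinuityZ3.Theorems
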